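import Summits.ResolutionOfSingularities.ResolutionOfSingularities.Theorems.UniformComplexityCampaignW82SpecializationNormalForms
import Mathlib.FieldTheory.AlgebraicClosure
import Mathlib.FieldTheory.IntermediateField.Adjoin.Basic
import Mathlib.Algebra.CharP.IntermediateField
import HarnessLib

/-!
# [OURS · L1 W8.2] THE ONE-STEP CLIMB BETWEEN ALGEBRAICALLY CLOSED FIELDS and the ALL-OR-NOTHING form — the
# re-based door-2 residual (`UniformComplexity` / `PrimeModelTransfer`) of slot W8.2; campaign statements,
# Theses-free module

Cell `res-hironaka` (run/shared/lean/pub/res-hironaka/), LADDER-RESOLUTION rung L (RESCUE), slot W8.2 of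
plan/RESCUE-SEED.md («PRIME-FIELD / UNIVERSALITY TRANSFER instead of descent»). SECOND DOOR: route
`UniformComplexity`, item `PrimeModelTransfer` (stmt-ResolutionOfSingularities-8933: for a prime `p`, resolution
of integral separated finite-type schemes over the algebraically closed fields ALGEBRAIC over `𝔽_p` ⇒ the same over
EVERY algebraically closed field of characteristic `p`). Statement-only file (typer res-L1-type-o6, statement-only
lane; two-lane rule: the slot's prover res-L1-s82-pv-2 proves AGAINST these names in its own Theorems files):
four OURS `Prop`s and nine anchors (pure logic, plus Mathlib instances where flagged); NOTHING is proved about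
resolution of singularities here and nothing is asserted.

WHY THIS FILE (hand-over res-L1-s82-pv-2 → res-L1-type-o6, STATUS 2026-08-27T01:57:39Z «RE-BASE THE DOOR-2
RESIDUAL»). With the SPECIALIZATION theorem landed (p483756 / p484634:
`Theorems.PrimeModelTransfer.integralResOver_of_integralResOver_extension` — `K` algebraically closed, `L ⊇ K`
perfect, resolution over `L` ⇒ resolution over `K`), the prover has LANDED
(`Theorems/UniformComplexityCampaignW82SpecializationLinks.lean`, p485462 → v2 p486991, namespace
`…Theorems.PrimeModelTransfer`; Theses-importing leaf) two EQUIVALENT normal forms of the crux: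
`primeModelTransfer_iff_climbAlgClosedStep` — `PrimeModelTransfer ↔` for every prime `p`, every algebraically
closed `M` of characteristic `p` with resolution, every algebraically closed `K ⊇ M` and every `t : K`, resolution
over the relative algebraic closure `(M(t))^{alg} ∩ K = algebraicClosure M⟮t⟯ K` — and
`primeModelTransfer_iff_forall_isAlgClosed` — `PrimeModelTransfer ↔` for every prime `p`, resolution over ONE
algebraically closed field of characteristic `p` implies resolution over ALL of them («all-or-nothing»). So the
EXACT door-2 residual is the one-step climb between ALGEBRAICALLY CLOSED fields — no perfect closure, no
`RatFunc`, no purely inseparable extension in the statement — whereas the residual of record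
`∀ p, PerfectionStepAlgClosureFgDimLe p ⊤` / `ClimbRatFuncPerfAlgClosed p` (p475047 / p470934; targets the
perfect closure `M(t)^{perf}`) is SUFFICIENT (closers p470915 / p476882) but carries a Galois-descent component
(`Res((M(t))^{alg}) ⇒ Res(M(t)^{perf})` would be the crux `DescentAlgclosedToPerfect`, stmt-0550) and is NOT
implied by the crux. This module types the two exact forms as OURS names, so that the prover's
`PrimeModelTransfer ↔ ∀ p, p.Prime → ClimbAlgClosedStep p` is an `Iff.rfl`-composition with its
`primeModelTransfer_iff_climbAlgClosedStep` (the body of `ClimbAlgClosedStep p` below is the prover's unfolded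
right-hand side BINDER FOR BINDER — at v2 time a fact of record: the right-hand sides of the landed
`primeModelTransfer_iff_climbAlgClosedStep` / `primeModelTransfer_iff_forall_isAlgClosed` (p486991, l.185–192 /
l.100–106 of that file) at a prime `p` ARE the bodies of `ClimbAlgClosedStep p` / `AlgClosedAllOrNothing p`
verbatim, lane B res-L1-ref-b2 STATUS 2026-08-27T02:25:20Z — and its target block is the one of the landed
`Theorems.PrimeModelTransfer.hasResolution_algebraicClosure_adjoin_simple`, p470438), together with their graded
forms and the pure-logic anchors. The by-name compositions themselves import the route file and stay the prover's.

BUILD RULE (cell, director-resolution 2026-08-26T18:53:29Z (B)): OURS vocabulary file, THESES-FREE BY BIRTH —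
imports only the Theses-free OURS module `…Theorems.UniformComplexityCampaignW82SpecializationNormalForms`
(p481773: `AlgClosedRes`, `ClimbAlgClosed`, `PrimeModelTransferAt`; itself importing only
`Literature.AlgebraicGeometry.Resolution.ResolutionOfSingularities` and Mathlib), Mathlib
(`FieldTheory.AlgebraicClosure` for the relative algebraic closure `algebraicClosure F E : IntermediateField F E`,
`FieldTheory.IntermediateField.Adjoin.Basic` for `IntermediateField.adjoin`, `Algebra.CharP.IntermediateField` for
the characteristic of intermediate fields) and `HarnessLib`. The by-name identifications with
`Theses.UniformComplexity.PrimeModelTransfer` belong in the prover's Theses-importing Links file, not here.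

HONEST FRAMING. The `def`s below are OURS — campaign statements that REPLACE THE ROLE of a printed item of
H. Hironaka's manuscript *Resolution of singularities in positive characteristics* (2017-03-23, [Hironaka2017],
lit key `paper:url-3343fd9e678b`; PDF page = printed page, `l.` = line of the page text file) — namely §17 ¶2,
p.89 l.59–62: «In this work the base field K is always assumed to be a finite field or Z/pZ because our
resolution is for all dimension. When the K has transcendence degree d we can reformulate the resolution problem
to the case of dimension d + dim Z.» (typed AS PRINTED, not asserted, as `S17Methodology.U89_2` / `U89_3` /
`U89_3_ours`, Literature/AlgebraicGeometry/Hironaka2017/S17Methodology/R100Methodology.lean, p455149; locator as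
in the sibling module p481773, lane-checked OURS-desk #62). The printed sentence claims SUFFICIENCY of the prime
field; the `Prop`s below say, in the summit's non-embedded idiom and for ALGEBRAICALLY CLOSED fields only (door 2's
universe), what that sufficiency is EQUIVALENT to according to the prover's kernel-checked links. Hironaka's
statements are CANDIDATES under adjudication (D-0012/D-0089); nothing here is attributed to the author and no
verdict on the manuscript is implied. AI typing, weaker than expert review.

CONTENTS (namespace `…Theorems.CampaignW82`, all `Prop`s closed):
* `ClimbAlgClosedStep p` — THE ONE-STEP CLIMB BETWEEN ALGEBRAICALLY CLOSED FIELDS (the exact residual; requested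
  signature verbatim) and its graded form `ClimbAlgClosedStepDimLe p m n` (dimension `≤ m` in the hypothesis,
  `≤ n` in the conclusion);
* `AlgClosedAllOrNothing p` — resolution over ONE algebraically closed field of characteristic `p` implies
  `AlgClosedRes p` (resolution over ALL of them), and its graded form `AlgClosedAllOrNothingDimLe p m n`;
* anchors: `climbAlgClosedStep_iff_top`, `climbAlgClosedStepDimLe_mono`, `algClosedAllOrNothing_iff_top`,
  `algClosedAllOrNothingDimLe_mono`, `algClosedAllOrNothing_of_algClosedRes`,
  `algClosedAllOrNothingDimLe_of_algClosedRes`, `climbAlgClosedStepDimLe_of_algClosedAllOrNothingDimLe`,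
  `climbAlgClosedStep_of_algClosedAllOrNothing`, `climbAlgClosedStep_of_algClosedRes`.

THEOREMS OF THE PROVER (NOT proved here). LANDED at v2 time (p486991, statements with these bodies unfolded, no
import of this module): `PrimeModelTransfer ↔ ∀ p, p.Prime → ClimbAlgClosedStep p`-body
(`primeModelTransfer_iff_climbAlgClosedStep`) and `PrimeModelTransfer ↔ ∀ p, p.Prime → AlgClosedAllOrNothing p`-body
(`primeModelTransfer_iff_forall_isAlgClosed`); the residual of record implies the exact one
(`climbAlgClosedStep_of_climbRatFuncPerfAlgClosed`). STILL INTENDED: the `p`-slices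
`PrimeModelTransferAt p ↔ ClimbAlgClosedStep p ↔ AlgClosedAllOrNothing p` for prime `p` («⇐» of the first by the
tower of algebraically closed subfields and the descent from perfect subfields,
`exists_isAlgClosed_subfield_hasResolution_of_step` / `hasResolution_of_perfectSubfields`; «⇒» by SPECIALIZATION
p484634 down to `𝔽_p^{alg} ∩ M` — `integralResOver_of_isAlgClosed_of_primeModelHyp` — the algebraicity lemma
`pow_prime_pow_eq_self_of_isAlgebraic` and transport `hasResolution_of_integralResOver_ringEquiv`, p470438);
`ClimbAlgClosed p → ClimbAlgClosedStep p` (the relative algebraic closure of `M(t)` in `K` has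
transcendence degree `≤ 1` over `M` — a transcendence-degree lemma, not pure logic) and conversely up to
transport (an algebraically closed `K` with `Algebra.trdeg M K ≤ 1` is `algebraicClosure M⟮t⟯ K = ⊤` for a
suitable `t`). The anchors below give only the pure-logic directions.

BARRIERS (`Literature/Barriers/ResolutionOfSingularities/`; read, not used): the statements below mention no
imperfect field and no inseparable base change, so the transport barriers (`RegularNotGeometricallyRegular.lean`;
`InseparableBaseChangeResolution.lean`: `not_hasResolution_pullback_extField`,
`not_isRegular_stable_groundFieldExtension`; `FrobeniusTwistResolution.lean`: `not_hasResolution_Spec_frobTwist`)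
are not met BY THE STATEMENTS. They evade nothing: `ClimbAlgClosedStep p` is EQUIVALENT to the crux's `p`-slice
(prover's links), and every known route to it passes through resolution over the imperfect field `M(t)` or its
perfect closure (p470934 / p475047), exactly where those barriers bite; the re-basing only removes from the
RESIDUAL the Galois-descent component that the crux does not demand.

VACUITY SELF-CHECK (one line per decl in the docstrings): for prime `p` no `Prop` below is trivially false (each
follows from `AlgClosedRes p`, an instance of the summit conjunct `ResolutionInChar p`); none is trivially true —
the slices `t` algebraic over `M` of `ClimbAlgClosedStep p` are idle up to transport (then
`algebraicClosure M⟮t⟯ K` is `M`-isomorphic to `M`, `M` being algebraically closed), the content is at `t`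
transcendental (e.g. `M = 𝔽̄_p`: resolution over `(𝔽̄_p(t))^{alg} ∩ K` in dimension `≥ 4`, open); the graded forms
are trivially true exactly at conclusion grade `n = ⊥` (integral schemes are nonempty) and, at `n ≤ 3`, hold
MODULO THE UNDISCHARGED NAMED FACT F-02 (`CossartPiltant2019`, resolution in dimension `≤ 3` over any ground field,
taken as the hypothesis `(h : CossartPiltant2019)` of `Resolution.hasResolution_of_dim_le_three`; no
`CossartPiltant2019_holds` in the tree — conditional results, not theorems outright) — open from `n = 4` on.
Composite `p > 1`: every
`Prop` is vacuous (no field of that characteristic); `p = 0`: not intended (every W8.2 consumer instantiates at a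
prime).

v2 (DOCSTRING-ONLY supersede, res-L1-type-o6 gen 8, 2026-08-27; OURS-desk #75 lane-B NIT res-L1-ref-b2 STATUS
02:25:20Z): (a) the dimension-`≤ 3` rungs are stated as holding MODULO the undischarged named fact F-02
(`CossartPiltant2019`), not as theorems outright (four places); (b) the pointers to the prover's normal forms now
name the LANDED file `Theorems/UniformComplexityCampaignW82SpecializationLinks.lean` (p485462 → v2 p486991) instead
of «to be landed». All thirteen declarations are byte-identical to v1 (p486396, tree sha16 4931e5fa0de3ed1c) in
statement and body; only this module docstring and the docstrings of the four `def`s changed.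

## References (vocabulary and locators only; nothing cited as a premise)
* H. Hironaka, ms. 2017-03-23, §17 ¶2 p.89 l.59–62 — under adjudication, quoted for the role replaced, not
  asserted. [Hironaka2017]
* Theses/UniformComplexity.lean item stmt-8933; STATUS 2026-08-27T01:49:02Z / 01:57:39Z (res-L1-s82-pv-2 g2);
  L/res-L1-s82-pv-2/DOOR2-KERNEL.md; L/res-L1-type-o6/W82-TYPED-MAP.md — cell files, OURS.
* EGA IV₃ (1966) Thm. 8.10.5 — docstring vocabulary for the prover's specialization only. [folklore]
-/

noncomputable section

set_option linter.dupNamespace false -- mandated namespace of this single-conjunct summit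

open _root_.CategoryTheory _root_.AlgebraicGeometry
open Literature.AlgebraicGeometry.Resolution

namespace Summit.ResolutionOfSingularities.ResolutionOfSingularities.Theorems.CampaignW82

/-! ## The one-step climb between algebraically closed fields (the exact door-2 residual) -/

/-- [OURS · L1 W8.2 door 2] replaces the role of §17 ¶2, p.89 l.59–62 («a finite field or Z/pZ because our
resolution is for all dimension … When the K has transcendence degree d we can reformulate …»;
`S17Methodology.U89_2` / `U89_3`) ONE TRANSCENDENTAL AT A TIME BETWEEN ALGEBRAICALLY CLOSED FIELDS, as the EXACT
residual of the crux `PrimeModelTransfer` (stmt-ResolutionOfSingularities-8933) at one prime `p`; NOT a statement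
of the manuscript. THE ALGEBRAICALLY CLOSED ONE-STEP CLIMB at `p`: for every algebraically closed field `M` of
characteristic `p` over which every integral separated `M`-scheme of finite type has a resolution
(`Scheme.HasResolution`), every algebraically closed field `K` that is an `M`-algebra (a field extension
`M ⊆ K`) and every element `t : K`, every integral separated scheme of finite type over the RELATIVE ALGEBRAIC
CLOSURE `algebraicClosure M⟮t⟯ K` of `M⟮t⟯ = IntermediateField.adjoin M {t}` inside `K` — an algebraically closed
subfield of `K` (Mathlib instance `algebraicClosure.isAlgClosure`), `M`-isomorphic to `(M(t))^{alg}` when `t` is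
transcendental over `M` and to `M` when `t` is algebraic — has a resolution. Signature requested verbatim by
res-L1-s82-pv-2 (STATUS 2026-08-27T01:57:39Z); its hypothesis block is the one of `ClimbAlgClosed p` /
`ClimbRatFuncPerfAlgClosed p` and its target block is the one of the landed
`Theorems.PrimeModelTransfer.hasResolution_algebraicClosure_adjoin_simple` (p470438), binder for binder, so that
the prover's `Theses.UniformComplexity.PrimeModelTransfer ↔ ∀ p, p.Prime → ClimbAlgClosedStep p` is an
`Iff.rfl`-composition with its LANDED `PrimeModelTransfer.primeModelTransfer_iff_climbAlgClosedStep`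
(`Theorems/UniformComplexityCampaignW82SpecializationLinks.lean`, p485462 → v2 p486991; its right-hand side at `p`
is this body verbatim; «⇐» tower of algebraically closed subfields `exists_isAlgClosed_subfield_hasResolution_of_step`
+ descent from perfect subfields `hasResolution_of_perfectSubfields`; «⇒» SPECIALIZATION p484634 via
`integralResOver_of_isAlgClosed_of_primeModelHyp`). Compare `ClimbAlgClosed p` (p481773:
target every algebraically closed `K ⊇ M` with `Algebra.trdeg M K ≤ 1` — the same fields up to isomorphism; the
two `Prop`s are equivalent by a transcendence-degree lemma and transport, the prover's, not an anchor here) and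
the residual of record `ClimbRatFuncPerfAlgClosed p` (p470934: target the perfect closure `M(t)^{perf}` —
SUFFICIENT for this `Prop` via the landed algebraic climb — by name
`PrimeModelTransfer.climbAlgClosedStep_of_climbRatFuncPerfAlgClosed`, p486991 — but stronger by a Galois-descent
component, `DescentAlgclosedToPerfect` stmt-0550, which the crux does not demand). Implied outright by
`AlgClosedRes p`
(`climbAlgClosedStep_of_algClosedRes`) and by `AlgClosedAllOrNothing p`
(`climbAlgClosedStep_of_algClosedAllOrNothing`). Graded form `ClimbAlgClosedStepDimLe p m n`; this is its grade
`(⊤, ⊤)` (`climbAlgClosedStep_iff_top`). Open-problem grade (equivalent to the crux's `p`-slice). Vacuity (prime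
`p`): the slices with `t` algebraic over `M` are idle up to transport (`algebraicClosure M⟮t⟯ K ≅ M`); at `t`
transcendental the statement contains resolution over `(𝔽̄_p(t))^{alg} ∩ K` in every dimension given it over
`𝔽̄_p` — not trivially true; never trivially false (follows from `AlgClosedRes p`); composite `p > 1` vacuous.
[folklore] -/
def ClimbAlgClosedStep (p : ℕ) : Prop :=
  ∀ (M : Type) [Field M] [CharP M p] [IsAlgClosed M],
    (∀ (X : Scheme.{0}) (f : X ⟶ Spec (.of M)),
        IsSeparated f → LocallyOfFiniteType f → QuasiCompact f → IsIntegral X → Scheme.HasResolution X) →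
      ∀ (K : Type) [Field K] [IsAlgClosed K] [Algebra M K] (t : K) (X : Scheme.{0})
        (f : X ⟶ Spec (.of (algebraicClosure (IntermediateField.adjoin M ({t} : Set K)) K))),
        IsSeparated f → LocallyOfFiniteType f → QuasiCompact f → IsIntegral X → Scheme.HasResolution X

/-- [OURS · L1 W8.2 door 2] replaces the role of §17 ¶2, p.89 l.59–62 one transcendental at a time between
algebraically closed fields, GRADED BY DIMENSION on both sides; NOT a statement of the manuscript. THE GRADED
ALGEBRAICALLY CLOSED ONE-STEP CLIMB at `p`, bounds `(m, n)` in `WithBot ℕ∞` (the value type of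
`topologicalKrullDim`): for every algebraically closed `M` of characteristic `p`, if every integral separated
`M`-scheme of finite type of dimension `≤ m` has a resolution, then for every algebraically closed `M`-algebra
`K` and every `t : K`, every integral separated scheme of finite type of dimension `≤ n` over
`algebraicClosure M⟮t⟯ K` has a resolution. `(⊤, ⊤)` is `ClimbAlgClosedStep p` (`climbAlgClosedStep_iff_top`);
monotone in `m`, antitone in `n` (`climbAlgClosedStepDimLe_mono`); implied at every `(m, n)` by
`AlgClosedAllOrNothingDimLe p m n` (`climbAlgClosedStepDimLe_of_algClosedAllOrNothingDimLe`). The diagonal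
`(n, n)` is the grade that iterates up a tower of algebraically closed subfields (prover's graded tower, if
wanted); `(n + 1, n)` ⇐ the residual of record at grade `n` via the algebraic climb (prover's). Rungs (not proved
here): every `(m, n)` with `n ≤ 3` holds MODULO the undischarged named fact F-02 (`CossartPiltant2019`,
resolution in dimension `≤ 3` over any field, the hypothesis `(h : CossartPiltant2019)` of
`Resolution.hasResolution_of_dim_le_three` — a conditional result, not a theorem outright); `(4, 4)` / `(⊤, 4)` are
the first open grades. Vacuity (prime `p`): trivially
true exactly at `n = ⊥` (integral schemes are nonempty); at `m = ⊥` the hypothesis is idle and the `Prop` is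
resolution in dimension `≤ n` over every `(M(t))^{alg} ∩ K` outright; never trivially false; composite `p > 1`
vacuous. [folklore] -/
def ClimbAlgClosedStepDimLe (p : ℕ) (m n : WithBot ℕ∞) : Prop :=
  ∀ (M : Type) [Field M] [CharP M p] [IsAlgClosed M],
    (∀ (X : Scheme.{0}) (f : X ⟶ Spec (.of M)),
        IsSeparated f → LocallyOfFiniteType f → QuasiCompact f → IsIntegral X →
          topologicalKrullDim X ≤ m → Scheme.HasResolution X) →
      ∀ (K : Type) [Field K] [IsAlgClosed K] [Algebra M K] (t : K) (X : Scheme.{0})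
        (f : X ⟶ Spec (.of (algebraicClosure (IntermediateField.adjoin M ({t} : Set K)) K))),
        IsSeparated f → LocallyOfFiniteType f → QuasiCompact f → IsIntegral X →
          topologicalKrullDim X ≤ n → Scheme.HasResolution X

/-! ## The all-or-nothing form -/

/-- [OURS · L1 W8.2 door 2] replaces the role of §17 ¶2, p.89 l.59–62 («a finite field or Z/pZ because our
resolution is for all dimension») for ALGEBRAICALLY CLOSED fields as the ALL-OR-NOTHING normal form of the crux
`PrimeModelTransfer` (stmt-ResolutionOfSingularities-8933) at one prime `p`; NOT a statement of the manuscript.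
RESOLUTION OVER ALGEBRAICALLY CLOSED FIELDS OF CHARACTERISTIC `p` IS ALL-OR-NOTHING: if over SOME algebraically
closed field `M` of characteristic `p` every integral separated scheme of finite type has a resolution, then
`AlgClosedRes p` — the same holds over EVERY algebraically closed field of characteristic `p` (p481773; by name,
so the conclusion block is the crux's, binders `(K : Type) [Field K] [CharP K p] [IsAlgClosed K]`). The prover's
LANDED `PrimeModelTransfer.primeModelTransfer_iff_forall_isAlgClosed`
(`Theorems/UniformComplexityCampaignW82SpecializationLinks.lean`, p485462 → v2 p486991; its right-hand side at `p`
is this body verbatim) identifies `Theses.UniformComplexity.PrimeModelTransfer` with `∀ p, p.Prime →` this `Prop`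
(«⇒»: SPECIALIZATION p484634 from `M` down to `𝔽_p^{alg} ∩ M`, the algebraicity lemma and transport of p470438 give
the crux hypothesis `PrimeClosureRes p` — `integralResOver_of_isAlgClosed_of_primeModelHyp` — then the crux; «⇐»:
`𝔽̄_p = AlgebraicClosure (ZMod p)` is one such `M`). Implied by
`AlgClosedRes p` (`algClosedAllOrNothing_of_algClosedRes`, pure logic); implies `ClimbAlgClosedStep p`
(`climbAlgClosedStep_of_algClosedAllOrNothing`: the target field is algebraically closed of characteristic `p`).
Graded form `AlgClosedAllOrNothingDimLe p m n`; this is its grade `(⊤, ⊤)` (`algClosedAllOrNothing_iff_top`).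
Open-problem grade (equivalent to the crux's `p`-slice). Vacuity (prime `p`): not trivially true (it contains
`PrimeModelTransferAt p` up to the prover's algebraicity/transport lemmas: take `M = 𝔽̄_p`), and not settled by a
false antecedent (resolution over `𝔽̄_p` in all dimensions is open; dimension `≤ 3` only modulo the undischarged
named fact F-02); never trivially false (follows from `AlgClosedRes p`); composite `p > 1` vacuous. [folklore] -/
def AlgClosedAllOrNothing (p : ℕ) : Prop :=
  ∀ (M : Type) [Field M] [CharP M p] [IsAlgClosed M],
    (∀ (X : Scheme.{0}) (f : X ⟶ Spec (.of M)),
        IsSeparated f → LocallyOfFiniteType f → QuasiCompact f → IsIntegral X → Scheme.HasResolution X) →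
      AlgClosedRes p

/-- [OURS · L1 W8.2 door 2] replaces the role of §17 ¶2, p.89 l.59–62 for algebraically closed fields as the
all-or-nothing form GRADED BY DIMENSION; NOT a statement of the manuscript. THE GRADED ALL-OR-NOTHING FORM at `p`,
bounds `(m, n)`: if over some algebraically closed `M` of characteristic `p` every integral separated scheme of
finite type of dimension `≤ m` has a resolution, then over every algebraically closed `K` of characteristic `p`
every integral separated scheme of finite type of dimension `≤ n` has one. `(⊤, ⊤)` is `AlgClosedAllOrNothing p`
(`algClosedAllOrNothing_iff_top`); monotone in `m`, antitone in `n` (`algClosedAllOrNothingDimLe_mono`); every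
grade follows from `AlgClosedRes p` (`algClosedAllOrNothingDimLe_of_algClosedRes`); each grade implies the same
grade of the one-step climb (`climbAlgClosedStepDimLe_of_algClosedAllOrNothingDimLe`). The diagonal `(n, n)`
(«resolution in dimension `≤ n` over algebraically closed fields of characteristic `p` is all-or-nothing») is the
grade the prover's specialization (`dim X_L = dim X`) and graded tower would make equivalent to
`ClimbAlgClosedStepDimLe p n n` — intended, not proved here. Rungs (not proved here): `n ≤ 3` modulo the
undischarged named fact F-02 (`CossartPiltant2019`; conditional, not outright); `(4, 4)` first open. Vacuity
(prime `p`): trivially true exactly at `n = ⊥`; at `m = ⊥` the hypothesis is idle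
and the `Prop` is graded `AlgClosedRes` outright; never trivially false; composite `p > 1` vacuous. [folklore] -/
def AlgClosedAllOrNothingDimLe (p : ℕ) (m n : WithBot ℕ∞) : Prop :=
  ∀ (M : Type) [Field M] [CharP M p] [IsAlgClosed M],
    (∀ (X : Scheme.{0}) (f : X ⟶ Spec (.of M)),
        IsSeparated f → LocallyOfFiniteType f → QuasiCompact f → IsIntegral X →
          topologicalKrullDim X ≤ m → Scheme.HasResolution X) →
      ∀ (K : Type) [Field K] [CharP K p] [IsAlgClosed K] (X : Scheme.{0}) (f : X ⟶ Spec (.of K)),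
        IsSeparated f → LocallyOfFiniteType f → QuasiCompact f → IsIntegral X →
          topologicalKrullDim X ≤ n → Scheme.HasResolution X

/-! ## Anchors (pure logic unless flagged) -/

/-- **The ungraded one-step climb is the grade `(⊤, ⊤)`** (pure logic, `le_top`). [folklore] -/
theorem climbAlgClosedStep_iff_top (p : ℕ) : ClimbAlgClosedStep p ↔ ClimbAlgClosedStepDimLe p ⊤ ⊤ := by
  constructor
  · intro h M _ _ _ hM K _ _ _ t X f hs hl hq hX _
    exact h M (fun Y g hs' hl' hq' hY => hM Y g hs' hl' hq' hY le_top) K t X f hs hl hq hX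
  · intro h M _ _ _ hM K _ _ _ t X f hs hl hq hX
    exact h M (fun Y g hs' hl' hq' hY _ => hM Y g hs' hl' hq' hY) K t X f hs hl hq hX le_top

/-- **Monotonicity of the graded one-step climb** (pure logic): `ClimbAlgClosedStepDimLe p m n →
ClimbAlgClosedStepDimLe p m' n'` whenever `m ≤ m'` and `n' ≤ n`. [folklore] -/
theorem climbAlgClosedStepDimLe_mono {p : ℕ} {m m' n n' : WithBot ℕ∞} (hm : m ≤ m') (hn : n' ≤ n)
    (h : ClimbAlgClosedStepDimLe p m n) : ClimbAlgClosedStepDimLe p m' n' :=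
  fun M _ _ _ hM K _ _ _ t X f hs hl hq hX hd =>
    h M (fun Y g hs' hl' hq' hY hdY => hM Y g hs' hl' hq' hY (hdY.trans hm)) K t X f hs hl hq hX
      (hd.trans hn)

/-- **The ungraded all-or-nothing form is the grade `(⊤, ⊤)`** (pure logic, `le_top`). [folklore] -/
theorem algClosedAllOrNothing_iff_top (p : ℕ) : AlgClosedAllOrNothing p ↔ AlgClosedAllOrNothingDimLe p ⊤ ⊤ := by
  constructor
  · intro h M _ _ _ hM K _ _ _ X f hs hl hq hX _
    exact h M (fun Y g hs' hl' hq' hY => hM Y g hs' hl' hq' hY le_top) K X f hs hl hq hX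
  · intro h M _ _ _ hM K _ _ _ X f hs hl hq hX
    exact h M (fun Y g hs' hl' hq' hY _ => hM Y g hs' hl' hq' hY) K X f hs hl hq hX le_top

/-- **Monotonicity of the graded all-or-nothing form** (pure logic): `AlgClosedAllOrNothingDimLe p m n →
AlgClosedAllOrNothingDimLe p m' n'` whenever `m ≤ m'` and `n' ≤ n`. [folklore] -/
theorem algClosedAllOrNothingDimLe_mono {p : ℕ} {m m' n n' : WithBot ℕ∞} (hm : m ≤ m') (hn : n' ≤ n)
    (h : AlgClosedAllOrNothingDimLe p m n) : AlgClosedAllOrNothingDimLe p m' n' :=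
  fun M _ _ _ hM K _ _ _ X f hs hl hq hX hd =>
    h M (fun Y g hs' hl' hq' hY hdY => hM Y g hs' hl' hq' hY (hdY.trans hm)) K X f hs hl hq hX (hd.trans hn)

/-- **The all-or-nothing form is a weakening of the crux conclusion** (pure logic: the hypothesis is idle).
[folklore] -/
theorem algClosedAllOrNothing_of_algClosedRes {p : ℕ} (h : AlgClosedRes p) : AlgClosedAllOrNothing p :=
  fun _ _ _ _ _ => h

/-- **Every grade of the all-or-nothing form follows from the crux conclusion** (pure logic). [folklore] -/
theorem algClosedAllOrNothingDimLe_of_algClosedRes {p : ℕ} (h : AlgClosedRes p) (m n : WithBot ℕ∞) :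
    AlgClosedAllOrNothingDimLe p m n :=
  fun _ _ _ _ _ K _ _ _ X f hs hl hq hX _ => h K X f hs hl hq hX

/-- **Each grade of the all-or-nothing form implies the same grade of the one-step climb**: the target field
`algebraicClosure M⟮t⟯ K` has characteristic `p` (Mathlib `charP_of_injective_algebraMap` along `M → K`, then the
instance `IntermediateField.charP'`) and is algebraically closed (`IsAlgClosure.isAlgClosed`, instance
`algebraicClosure.isAlgClosure` for `[IsAlgClosed K]`); otherwise pure logic. [folklore] -/
theorem climbAlgClosedStepDimLe_of_algClosedAllOrNothingDimLe {p : ℕ} {m n : WithBot ℕ∞}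
    (h : AlgClosedAllOrNothingDimLe p m n) : ClimbAlgClosedStepDimLe p m n :=
  fun M _ _ _ hM K _ _ _ t X f hs hl hq hX hd => by
    haveI : CharP K p := charP_of_injective_algebraMap (algebraMap M K).injective p
    haveI : CharP (algebraicClosure (IntermediateField.adjoin M ({t} : Set K)) K) p :=
      IntermediateField.charP' _ p
    haveI : IsAlgClosed (algebraicClosure (IntermediateField.adjoin M ({t} : Set K)) K) :=
      IsAlgClosure.isAlgClosed (IntermediateField.adjoin M ({t} : Set K))
    exact h M hM (algebraicClosure (IntermediateField.adjoin M ({t} : Set K)) K) X f hs hl hq hX hd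

/-- **The all-or-nothing form implies the one-step climb** (ungraded; via the grades `(⊤, ⊤)`). [folklore] -/
theorem climbAlgClosedStep_of_algClosedAllOrNothing {p : ℕ} (h : AlgClosedAllOrNothing p) :
    ClimbAlgClosedStep p :=
  (climbAlgClosedStep_iff_top p).2
    (climbAlgClosedStepDimLe_of_algClosedAllOrNothingDimLe ((algClosedAllOrNothing_iff_top p).1 h))

/-- **The one-step climb is a weakening of the crux conclusion**: `AlgClosedRes p → ClimbAlgClosedStep p`
(composition of the two previous anchors). Hence `PrimeModelTransferAt p → PrimeClosureRes p → ClimbAlgClosedStep p`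
by pure logic; the converse directions are the prover's. [folklore] -/
theorem climbAlgClosedStep_of_algClosedRes {p : ℕ} (h : AlgClosedRes p) : ClimbAlgClosedStep p :=
  climbAlgClosedStep_of_algClosedAllOrNothing (algClosedAllOrNothing_of_algClosedRes h)

end Summit.ResolutionOfSingularities.ResolutionOfSingularities.Theorems.CampaignW82

end
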